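import Mathlib
import HarnessLib

/-!
# Comb lemma, part I — roots of uniformly increasing functions of one real variable

Support file for crux item stmt-FinalStateConjecture-16893 (route LaminatedThreshold, crux A
`LaminatedThreshold`): the first of the files proving the REPAIRED abstract comb lemma of line
`heteroclinic_comb` (registered Stub 1 `stub_combLemma`, false as typed — `Negative.stub_combLemma_false` —
and true under the normalisation that the `t`-axis is `T`-invariant, proved in the last file of the series).
The comb lemma is a backward Hadamard graph transform; every step of it (the seed hypersurfaces as graphs,
the pulled-back sheets, their Lipschitz bounds, ordering and convergence) solves ONE real equation
`f t = 0` for a function `f` that is *uniformly increasing* on an interval,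
`c · (t − s) ≤ f t − f s` (`s ≤ t`, `c > 0`). This file is that one-variable toolkit (Mathlib only):

* `exists_root_of_continuousOn` — a continuous such `f` with `f a ≤ 0 ≤ f b` has a root in `[a, b]` (IVT);
* `dist_root_le` — a root `t₁` and any `t₂` satisfy `c · |t₁ − t₂| ≤ |f t₂|`, whence
  uniqueness (`root_unique`), comparison (`root_le_of_nonneg`, `root_lt_of_pos`, …) and stability of the
  root under perturbation of `f` (`dist_root_root_le`).

References: A. Katok, B. Hasselblatt, *Introduction to the modern theory of dynamical systems*, CUP 1995,
§6.2 (graph transform); the one-variable facts are folklore.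
-/

-- every `Summit.FinalStateConjecture.FinalStateConjecture.…` name repeats the summit = sub-problem segment (D-0017 layout)
set_option linter.dupNamespace false

noncomputable section

open Set Filter Metric
open scoped Topology

namespace Summit.FinalStateConjecture.FinalStateConjecture.Theorems.LaminatedThreshold.CombLemma

/-! Throughout, "`f` is `c`-uniformly increasing on `[a, b]`" is the HYPOTHESIS
`∀ s ∈ Icc a b, ∀ t ∈ Icc a b, s ≤ t → c * (t - s) ≤ f t - f s` (written out, no definition). -/

section OneVariable

variable {f g : ℝ → ℝ} {a b c : ℝ}

/-- A `c`-uniformly increasing function (`c > 0`) is strictly monotone on `[a, b]`. [folklore] -/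
theorem strictMonoOn_of_uniformlyIncr (hc : 0 < c)
    (hf : ∀ s ∈ Icc a b, ∀ t ∈ Icc a b, s ≤ t → c * (t - s) ≤ f t - f s) :
    StrictMonoOn f (Icc a b) := by
  intro s hs t ht hst
  have h := hf s hs t ht hst.le
  have : 0 < c * (t - s) := mul_pos hc (by linarith)
  linarith

/-- The basic two-point inequality: `c · |t − s| ≤ |f t − f s|` on `[a, b]`. [folklore] -/
theorem abs_sub_le_of_uniformlyIncr
    (hf : ∀ s ∈ Icc a b, ∀ t ∈ Icc a b, s ≤ t → c * (t - s) ≤ f t - f s)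
    {s t : ℝ} (hs : s ∈ Icc a b) (ht : t ∈ Icc a b) : c * |t - s| ≤ |f t - f s| := by
  rcases le_total s t with hst | hts
  · have h := hf s hs t ht hst
    rw [abs_of_nonneg (by linarith : 0 ≤ t - s)]
    exact h.trans (le_abs_self _)
  · have h := hf t ht s hs hts
    rw [abs_of_nonpos (by linarith : t - s ≤ 0), abs_sub_comm]
    have : c * -(t - s) = c * (s - t) := by ring
    rw [this]
    exact h.trans (le_abs_self _)

/-- **Existence of a root** (intermediate value theorem): a function continuous on `[a, b]` with
`f a ≤ 0 ≤ f b` vanishes somewhere on `[a, b]`. [folklore] -/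
theorem exists_root_of_continuousOn (hab : a ≤ b) (hcont : ContinuousOn f (Icc a b)) (ha : f a ≤ 0)
    (hb : 0 ≤ f b) : ∃ t ∈ Icc a b, f t = 0 := by
  have h := intermediate_value_Icc hab hcont
  exact h ⟨ha, hb⟩

/-- **Root versus any point**: if `f t₁ = 0` then `c · |t₁ − t₂| ≤ |f t₂|`. [folklore] -/
theorem dist_root_le
    (hf : ∀ s ∈ Icc a b, ∀ t ∈ Icc a b, s ≤ t → c * (t - s) ≤ f t - f s)
    {t₁ t₂ : ℝ} (ht₁ : t₁ ∈ Icc a b) (ht₂ : t₂ ∈ Icc a b) (h0 : f t₁ = 0) :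
    c * |t₁ - t₂| ≤ |f t₂| := by
  have h := abs_sub_le_of_uniformlyIncr hf ht₂ ht₁
  rw [h0, zero_sub, abs_neg] at h
  exact h

/-- **Uniqueness of the root** on `[a, b]`. [folklore] -/
theorem root_unique (hc : 0 < c)
    (hf : ∀ s ∈ Icc a b, ∀ t ∈ Icc a b, s ≤ t → c * (t - s) ≤ f t - f s)
    {t₁ t₂ : ℝ} (ht₁ : t₁ ∈ Icc a b) (ht₂ : t₂ ∈ Icc a b) (h₁ : f t₁ = 0) (h₂ : f t₂ = 0) :
    t₁ = t₂ := by
  have h := dist_root_le hf ht₁ ht₂ h₁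
  rw [h₂, abs_zero] at h
  have habs : |t₁ - t₂| ≤ 0 := by
    by_contra hne
    push Not at hne
    have : 0 < c * |t₁ - t₂| := mul_pos hc hne
    linarith
  have := abs_nonneg (t₁ - t₂)
  have h0 : |t₁ - t₂| = 0 := le_antisymm habs this
  rwa [abs_eq_zero, sub_eq_zero] at h0

/-- **Comparison, weak form**: if `f t₁ = 0` and `f t₂ ≤ 0` then `t₂ ≤ t₁`. [folklore] -/
theorem le_root_of_nonpos (hc : 0 < c)
    (hf : ∀ s ∈ Icc a b, ∀ t ∈ Icc a b, s ≤ t → c * (t - s) ≤ f t - f s)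
    {t₁ t₂ : ℝ} (ht₁ : t₁ ∈ Icc a b) (ht₂ : t₂ ∈ Icc a b) (h₁ : f t₁ = 0) (h₂ : f t₂ ≤ 0) :
    t₂ ≤ t₁ := by
  by_contra hlt
  push Not at hlt
  have h := hf t₁ ht₁ t₂ ht₂ hlt.le
  have : 0 < c * (t₂ - t₁) := mul_pos hc (by linarith)
  linarith

/-- **Comparison, weak form**: if `f t₁ = 0` and `0 ≤ f t₂` then `t₁ ≤ t₂`. [folklore] -/
theorem root_le_of_nonneg (hc : 0 < c)
    (hf : ∀ s ∈ Icc a b, ∀ t ∈ Icc a b, s ≤ t → c * (t - s) ≤ f t - f s)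
    {t₁ t₂ : ℝ} (ht₁ : t₁ ∈ Icc a b) (ht₂ : t₂ ∈ Icc a b) (h₁ : f t₁ = 0) (h₂ : 0 ≤ f t₂) :
    t₁ ≤ t₂ := by
  by_contra hlt
  push Not at hlt
  have h := hf t₂ ht₂ t₁ ht₁ hlt.le
  have : 0 < c * (t₁ - t₂) := mul_pos hc (by linarith)
  linarith

/-- **Comparison, strict form**: if `f t₁ = 0` and `f t₂ < 0` then `t₂ < t₁`. [folklore] -/
theorem lt_root_of_neg (hc : 0 < c)
    (hf : ∀ s ∈ Icc a b, ∀ t ∈ Icc a b, s ≤ t → c * (t - s) ≤ f t - f s)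
    {t₁ t₂ : ℝ} (ht₁ : t₁ ∈ Icc a b) (ht₂ : t₂ ∈ Icc a b) (h₁ : f t₁ = 0) (h₂ : f t₂ < 0) :
    t₂ < t₁ := by
  rcases lt_or_eq_of_le (le_root_of_nonpos hc hf ht₁ ht₂ h₁ h₂.le) with h | h
  · exact h
  · rw [h, h₁] at h₂; exact absurd h₂ (lt_irrefl 0)

/-- **Comparison, strict form**: if `f t₁ = 0` and `0 < f t₂` then `t₁ < t₂`. [folklore] -/
theorem root_lt_of_pos (hc : 0 < c)
    (hf : ∀ s ∈ Icc a b, ∀ t ∈ Icc a b, s ≤ t → c * (t - s) ≤ f t - f s)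
    {t₁ t₂ : ℝ} (ht₁ : t₁ ∈ Icc a b) (ht₂ : t₂ ∈ Icc a b) (h₁ : f t₁ = 0) (h₂ : 0 < f t₂) :
    t₁ < t₂ := by
  rcases lt_or_eq_of_le (root_le_of_nonneg hc hf ht₁ ht₂ h₁ h₂.le) with h | h
  · exact h
  · rw [← h, h₁] at h₂; exact absurd h₂ (lt_irrefl 0)

/-- **Stability of the root**: if `f` is `c`-uniformly increasing with root `t₁`, and `g` has root `t₂`
with `|f t₂ − g t₂| ≤ δ`, then `c · |t₁ − t₂| ≤ δ`. (Used with `g` = the defining function of a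
neighbouring sheet, or of the same sheet at a neighbouring base point.) [folklore] -/
theorem dist_root_root_le
    (hf : ∀ s ∈ Icc a b, ∀ t ∈ Icc a b, s ≤ t → c * (t - s) ≤ f t - f s)
    {t₁ t₂ δ : ℝ} (ht₁ : t₁ ∈ Icc a b) (ht₂ : t₂ ∈ Icc a b) (h₁ : f t₁ = 0) (h₂ : g t₂ = 0)
    (hδ : |f t₂ - g t₂| ≤ δ) : c * |t₁ - t₂| ≤ δ := by
  have h := dist_root_le hf ht₁ ht₂ h₁
  rw [h₂, sub_zero] at hδ
  exact h.trans hδ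

/-- **A priori bound on the root**: if `f t₁ = 0` and `t₀ ∈ [a, b]`, then `|t₁ − t₀| ≤ |f t₀| / c`.
[folklore] -/
theorem abs_root_sub_le_div (hc : 0 < c)
    (hf : ∀ s ∈ Icc a b, ∀ t ∈ Icc a b, s ≤ t → c * (t - s) ≤ f t - f s)
    {t₁ t₀ : ℝ} (ht₁ : t₁ ∈ Icc a b) (ht₀ : t₀ ∈ Icc a b) (h₁ : f t₁ = 0) :
    |t₁ - t₀| ≤ |f t₀| / c := by
  rw [le_div_iff₀ hc, mul_comm]
  exact dist_root_le hf ht₁ ht₀ h₁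

/-- **Uniform increase from a lower bound on difference quotients of two pieces**: if
`f = u − v` where `u` increases at rate at least `μ'` (`μ' (t − s) ≤ u t − u s`) and `v` varies at rate at
most `ℓ` (`|v t − v s| ≤ ℓ (t − s)`), then `f` is `(μ' − ℓ)`-uniformly increasing. This is how every
defining function of the graph transform (`u t = (T (x, t)).2`, `v t = g ((T (x, t)).1)`) is shown to be
uniformly increasing. [folklore] -/
theorem uniformlyIncr_sub {u v : ℝ → ℝ} {μ' ℓ : ℝ}
    (hu : ∀ s ∈ Icc a b, ∀ t ∈ Icc a b, s ≤ t → μ' * (t - s) ≤ u t - u s)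
    (hv : ∀ s ∈ Icc a b, ∀ t ∈ Icc a b, s ≤ t → |v t - v s| ≤ ℓ * (t - s)) :
    ∀ s ∈ Icc a b, ∀ t ∈ Icc a b, s ≤ t →
      (μ' - ℓ) * (t - s) ≤ (u t - v t) - (u s - v s) := by
  intro s hs t ht hst
  have h1 := hu s hs t ht hst
  have h2 := hv s hs t ht hst
  have h3 : v t - v s ≤ ℓ * (t - s) := (le_abs_self _).trans h2
  nlinarith

/-- **The root package** (registered support statement `uniformlyIncr_root_package` of crux item
stmt-FinalStateConjecture-16893): a continuous, `c`-uniformly increasing function on `[a, b]` with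
`f a ≤ 0 ≤ f b` has a root `t₁ ∈ [a, b]`, and `c · |t₁ − t₂| ≤ |f t₂|` for every `t₂ ∈ [a, b]` (so the root
is unique, and Lipschitz / monotone in any parameter through which `f` is Lipschitz / monotone). This is
the engine of every step of the graph-transform proof of the comb lemma. [folklore] -/
theorem uniformlyIncr_root_package : ∀ (f : ℝ → ℝ) (a b c : ℝ), a ≤ b → 0 < c → ContinuousOn f (Set.Icc a b) → (∀ s ∈ Set.Icc a b, ∀ t ∈ Set.Icc a b, s ≤ t → c * (t - s) ≤ f t - f s) → f a ≤ 0 → 0 ≤ f b → ∃ t₁ ∈ Set.Icc a b, f t₁ = 0 ∧ ∀ t₂ ∈ Set.Icc a b, c * |t₁ - t₂| ≤ |f t₂| := by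
  intro f a b c hab _hc hcont hf ha hb
  obtain ⟨t₁, ht₁, h₁⟩ := exists_root_of_continuousOn hab hcont ha hb
  exact ⟨t₁, ht₁, h₁, fun t₂ ht₂ ↦ dist_root_le hf ht₁ ht₂ h₁⟩

end OneVariable

end Summit.FinalStateConjecture.FinalStateConjecture.Theorems.LaminatedThreshold.CombLemma

end
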